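import Mathlib
import HarnessLib

/-!
# Darboux' theorem: a non-degenerate alternating form has a symplectic basis

Topic `LinearAlgebra/Alternating`; theorems only (no definition, no named fact).

[Lang2002, Ch. XV §8 "Alternating forms", Thm. 8.1]: *"Let `f` be an alternating form on `E`* [a finite
dimensional space over the field `k`]*, non-degenerate … there exists a basis … such that the matrix of the form
is `[[0, I], [-I, 0]]`"* — a SYMPLECTIC (Darboux) basis `{e_i, f_i}`: `f(e_i, e_j) = 0 = f(f_i, f_j)`,
`f(e_i, f_j) = δ_ij`; in particular `dim E` is even.  Mathlib has `LinearMap.BilinForm.IsAlt`, orthogonal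
complements and `isCompl_orthogonal_of_restrict_nondegenerate`, but not this classification; the tree has
variants with a prescribed Lagrangian (`Motives.exists_adapted_symplecticBasis`,
`Deligne1982.exists_basis_trace_darboux`).  We prove the plain statement (`exists_symplecticBasis`), with the
index of the basis an abstract finite type `ι ⊕ ι` (the form in which the tree's Heisenberg-group files,
e.g. `AdelicShapeUniqueness`, consume a polarisation `Xⁿ × Xⁿ`), and `two_mul_card_eq_finrank`.

Proof (the printed induction): pick `e ≠ 0`, `f` with `B(e, f) = 1`; `H = ⟨e, f⟩` is a hyperbolic plane on
which `B` is non-degenerate, so `V = H ⊕ H^⊥` (`isCompl_orthogonal_of_restrict_nondegenerate`), `B|_{H^⊥}` is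
alternating non-degenerate of dimension `dim V - 2`, and a symplectic basis of `H^⊥` extends by `e, f`.

This is step (b) of the adelic assembly for [GelbartRogawski1991, §3.1] ("`(W, φ)` a symplectic space over `F`
… `φ = Tr_{E/F}(Φ)`"): a Darboux basis of `(V, Tr Φ)` over `F` identifies `H(W_𝐀)` with the polarised
Heisenberg group of the dot product (`HeisenbergCoboundary.halfAltPolarEquiv`).

## References

* S. Lang, *Algebra*, 3rd ed., GTM 211 (2002), Ch. XV §8, Thm. 8.1. [Lang2002]
-/

noncomputable section

open Module Submodule
open LinearMap (BilinForm)

namespace Literature.LinearAlgebra.Alternating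

universe u

variable {K : Type*} [Field K]

/-- a non-zero vector pairs to `1` with someone, for a non-degenerate form. [folklore] -/
private theorem exists_apply_eq_one {V : Type u} [AddCommGroup V] [Module K V] {B : BilinForm K V}
    (hB : B.Nondegenerate) {e : V} (he : e ≠ 0) : ∃ f : V, B e f = 1 := by
  obtain ⟨f, hf⟩ : ∃ f, B e f ≠ 0 := by
    by_contra h
    push Not at h
    exact he (hB.1 e h)
  exact ⟨(B e f)⁻¹ • f, by rw [map_smul, smul_eq_mul, inv_mul_cancel₀ hf]⟩

/-- the hyperbolic plane `⟨e, f⟩`, `B(e, f) = 1`, of an alternating form: `e, f` are linearly independent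
and `B` is non-degenerate on their span. [cite: Lang2002, Ch. XV §8 Thm. 8.1] -/
private theorem hyperbolicPlane {V : Type u} [AddCommGroup V] [Module K V] {B : BilinForm K V}
    (hBa : B.IsAlt) {e f : V} (hef : B e f = 1) :
    LinearIndependent K ![e, f] ∧ (B.restrict (span K (Set.range ![e, f]))).Nondegenerate := by
  have hfe : B f e = -1 := by rw [← hBa.neg_eq, hef]
  have hee : B e e = 0 := hBa.self_eq_zero e
  have hff : B f f = 0 := hBa.self_eq_zero f
  have key : ∀ s t : K, B (s • e + t • f) e = -t ∧ B (s • e + t • f) f = s := fun s t => by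
    constructor
    · rw [map_add, map_smul, map_smul, LinearMap.add_apply, LinearMap.smul_apply, LinearMap.smul_apply,
        hee, hfe, smul_eq_mul, smul_eq_mul, mul_zero, zero_add, mul_neg, mul_one]
    · rw [map_add, map_smul, map_smul, LinearMap.add_apply, LinearMap.smul_apply, LinearMap.smul_apply,
        hef, hff, smul_eq_mul, smul_eq_mul, mul_one, mul_zero, add_zero]
  have hli : LinearIndependent K ![e, f] := by
    rw [LinearIndependent.pair_iff]
    intro s t hst
    have h := key s t
    rw [hst, map_zero, LinearMap.zero_apply, LinearMap.zero_apply] at h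
    exact ⟨h.2.symm, neg_eq_zero.mp h.1.symm⟩
  refine ⟨hli, ?_⟩
  have hrefl : (B.restrict (span K (Set.range ![e, f]))).IsRefl := fun x y h => hBa.isRefl _ _ h
  refine hrefl.nondegenerate_iff_separatingLeft.mpr ?_
  rintro ⟨x, hx⟩ h
  obtain ⟨c, hc⟩ := (Submodule.mem_span_range_iff_exists_fun K).mp hx
  rw [Fin.sum_univ_two, Matrix.cons_val_zero, Matrix.cons_val_one, Matrix.cons_val_fin_one] at hc
  have he' : e ∈ span K (Set.range ![e, f]) := subset_span ⟨0, rfl⟩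
  have hf' : f ∈ span K (Set.range ![e, f]) := subset_span ⟨1, rfl⟩
  have h1 : B x e = 0 := h ⟨e, he'⟩
  have h2 : B x f = 0 := h ⟨f, hf'⟩
  rw [← hc] at h1 h2
  rw [(key _ _).1, neg_eq_zero] at h1
  rw [(key _ _).2] at h2
  apply Subtype.ext
  change x = 0
  rw [← hc, h1, h2, zero_smul, zero_smul, add_zero]

/-- the induction of Darboux' theorem, on the dimension. [cite: Lang2002, Ch. XV §8 Thm. 8.1] -/
private theorem darboux_aux (n : ℕ) :
    ∀ (V : Type u) [AddCommGroup V] [Module K V] [FiniteDimensional K V] (B : BilinForm K V),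
      B.IsAlt → B.Nondegenerate → finrank K V = n →
      ∃ (ι : Type) (_ : Fintype ι) (_ : DecidableEq ι) (b : Basis (ι ⊕ ι) K V),
        (∀ i j, B (b (.inl i)) (b (.inl j)) = 0) ∧ (∀ i j, B (b (.inr i)) (b (.inr j)) = 0) ∧
        ∀ i j, B (b (.inl i)) (b (.inr j)) = if i = j then 1 else 0 := by
  induction n using Nat.strong_induction_on with
  | _ n ih =>
  intro V _ _ _ B hBa hB hn
  by_cases hV : finrank K V = 0
  · haveI : Subsingleton V := ⟨fun x y => by
      rw [finrank_zero_iff_forall_zero.mp hV x, finrank_zero_iff_forall_zero.mp hV y]⟩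
    exact ⟨PEmpty, inferInstance, inferInstance, Basis.empty _, fun i => i.elim, fun i => i.elim,
      fun i => i.elim⟩
  -- a hyperbolic plane `H = ⟨e, f⟩`
  obtain ⟨e, he⟩ : ∃ e : V, e ≠ 0 := by
    by_contra h
    push Not at h
    exact hV (finrank_zero_iff_forall_zero.mpr h)
  obtain ⟨f, hef⟩ := exists_apply_eq_one hB he
  obtain ⟨hli, hHnd⟩ := hyperbolicPlane hBa hef
  have hrefl : B.IsRefl := hBa.isRefl
  set H : Submodule K V := span K (Set.range ![e, f]) with hH
  have hcompl : IsCompl H (B.orthogonal H) := LinearMap.BilinForm.isCompl_orthogonal_of_restrict_nondegenerate hrefl hHnd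
  set W : Submodule K V := B.orthogonal H with hW
  -- the restriction to `W = H^⊥`
  have hWnd : (B.restrict W).Nondegenerate := by
    rw [LinearMap.BilinForm.restrict_nondegenerate_iff_isCompl_orthogonal hrefl, hW,
      LinearMap.BilinForm.orthogonal_orthogonal hB hrefl]
    exact hcompl.symm
  have hWalt : (B.restrict W).IsAlt := fun x => hBa (x : V)
  have hfinH : finrank K H = 2 := by
    rw [hH, finrank_span_eq_card hli, Fintype.card_fin]
  have hfinW : finrank K W = n - 2 := by
    rw [hW, LinearMap.BilinForm.finrank_orthogonal hB, hn, hfinH]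
  obtain ⟨ι, _, _, bW, hW11, hW22, hW12⟩ :=
    ih (n - 2) (by omega) W (B.restrict W) hWalt hWnd hfinW
  -- `H ⟂ W`
  have hHW : ∀ h : V, h ∈ H → ∀ w : W, B h w = 0 ∧ B w h = 0 := fun h hh w => by
    have h1 : B h w = 0 := (LinearMap.BilinForm.mem_orthogonal_iff.mp w.2) h hh
    exact ⟨h1, hrefl _ _ h1⟩
  have heH : e ∈ H := subset_span ⟨0, rfl⟩
  have hfH : f ∈ H := subset_span ⟨1, rfl⟩
  -- the basis `e, (e'_k), f, (f'_k)` indexed by `(Fin 1 ⊕ ι) ⊕ (Fin 1 ⊕ ι)`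
  let bH : Basis (Fin 1 ⊕ Fin 1) K H := (Basis.span hli).reindex (finSumFinEquiv (m := 1) (n := 1)).symm
  let bV : Basis ((Fin 1 ⊕ Fin 1) ⊕ (ι ⊕ ι)) K V :=
    (bH.prod bW).map (Submodule.prodEquivOfIsCompl H W hcompl)
  let b : Basis ((Fin 1 ⊕ ι) ⊕ (Fin 1 ⊕ ι)) K V := bV.reindex (Equiv.sumSumSumComm (Fin 1) (Fin 1) ι ι)
  have hbH1 : ∀ i : Fin 1, (bH (.inl i) : V) = e := fun i => by
    simp [bH, Fin.fin_one_eq_zero i]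
    rfl
  have hbH2 : ∀ i : Fin 1, (bH (.inr i) : V) = f := fun i => by
    simp [bH, Fin.fin_one_eq_zero i]
    rfl
  have hb11 : ∀ i : Fin 1, b (.inl (.inl i)) = e := fun i => by
    simp [b, bV, hbH1]
  have hb12 : ∀ k : ι, b (.inl (.inr k)) = (bW (.inl k) : V) := fun k => by
    simp [b, bV]
  have hb21 : ∀ i : Fin 1, b (.inr (.inl i)) = f := fun i => by
    simp [b, bV, hbH2]
  have hb22 : ∀ k : ι, b (.inr (.inr k)) = (bW (.inr k) : V) := fun k => by
    simp [b, bV]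
  have hrW : ∀ x y : W, B (x : V) (y : V) = B.restrict W x y := fun _ _ => rfl
  refine ⟨Fin 1 ⊕ ι, inferInstance, inferInstance, b, ?_, ?_, ?_⟩
  · rintro (i | k) (j | l)
    · rw [hb11, hb11]; exact hBa.self_eq_zero e
    · rw [hb11, hb12]; exact (hHW e heH _).1
    · rw [hb12, hb11]; exact (hHW e heH _).2
    · rw [hb12, hb12, hrW]; exact hW11 k l
  · rintro (i | k) (j | l)
    · rw [hb21, hb21]; exact hBa.self_eq_zero f
    · rw [hb21, hb22]; exact (hHW f hfH _).1
    · rw [hb22, hb21]; exact (hHW f hfH _).2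
    · rw [hb22, hb22, hrW]; exact hW22 k l
  · rintro (i | k) (j | l)
    · rw [hb11, hb21, hef, if_pos (by rw [Subsingleton.elim i j])]
    · rw [hb11, hb22, if_neg Sum.inl_ne_inr]; exact (hHW e heH _).1
    · rw [hb12, hb21, if_neg Sum.inr_ne_inl]; exact (hHW f hfH _).2
    · rw [hb12, hb22, hrW, hW12]
      by_cases hkl : k = l
      · rw [if_pos hkl, if_pos (congrArg Sum.inr hkl)]
      · rw [if_neg hkl, if_neg (fun h => hkl (Sum.inr_injective h))]

/-- **Darboux' theorem (existence of a symplectic basis).**  A non-degenerate alternating bilinear form `B` on a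
finite-dimensional vector space `V` over a field admits a basis `b : ι ⊕ ι → V` with
`B(b_{inl i}, b_{inl j}) = 0 = B(b_{inr i}, b_{inr j})`, `B(b_{inl i}, b_{inr j}) = δ_ij` and hence
`B(b_{inr i}, b_{inl j}) = -δ_ij` — the matrix `[[0, I], [-I, 0]]`. [cite: Lang2002, Ch. XV §8 Thm. 8.1] -/
theorem exists_symplecticBasis {V : Type u} [AddCommGroup V] [Module K V] [FiniteDimensional K V]
    {B : BilinForm K V} (hBa : B.IsAlt) (hB : B.Nondegenerate) :
    ∃ (ι : Type) (_ : Fintype ι) (_ : DecidableEq ι) (b : Basis (ι ⊕ ι) K V),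
      (∀ i j, B (b (.inl i)) (b (.inl j)) = 0) ∧ (∀ i j, B (b (.inr i)) (b (.inr j)) = 0) ∧
      (∀ i j, B (b (.inl i)) (b (.inr j)) = if i = j then 1 else 0) ∧
      ∀ i j, B (b (.inr i)) (b (.inl j)) = if i = j then -1 else 0 := by
  obtain ⟨ι, _, _, b, h11, h22, h12⟩ := darboux_aux (finrank K V) V B hBa hB rfl
  refine ⟨ι, inferInstance, inferInstance, b, h11, h22, h12, fun i j => ?_⟩
  rw [← hBa.neg_eq, h12]
  by_cases h : j = i
  · rw [if_pos h, if_pos h.symm]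
  · rw [if_neg h, if_neg (fun h' => h h'.symm), neg_zero]

/-- **a symplectic space is even-dimensional**: `2 · #ι = dim V` for any symplectic basis indexed by `ι ⊕ ι`,
in particular for the one of `exists_symplecticBasis`. [cite: Lang2002, Ch. XV §8 Thm. 8.1] -/
theorem two_mul_card_eq_finrank {V : Type u} [AddCommGroup V] [Module K V] {ι : Type*} [Fintype ι]
    (b : Basis (ι ⊕ ι) K V) : 2 * Fintype.card ι = finrank K V := by
  rw [finrank_eq_card_basis b, Fintype.card_sum, two_mul]

/-- Darboux with the even dimension made explicit: `dim V = 2 #ι`. [cite: Lang2002, Ch. XV §8 Thm. 8.1] -/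
theorem exists_symplecticBasis_card {V : Type u} [AddCommGroup V] [Module K V] [FiniteDimensional K V]
    {B : BilinForm K V} (hBa : B.IsAlt) (hB : B.Nondegenerate) :
    ∃ (ι : Type) (_ : Fintype ι) (_ : DecidableEq ι) (b : Basis (ι ⊕ ι) K V),
      2 * Fintype.card ι = finrank K V ∧
      (∀ i j, B (b (.inl i)) (b (.inl j)) = 0) ∧ (∀ i j, B (b (.inr i)) (b (.inr j)) = 0) ∧
      ∀ i j, B (b (.inl i)) (b (.inr j)) = if i = j then 1 else 0 := by
  obtain ⟨ι, _, _, b, h11, h22, h12, -⟩ := exists_symplecticBasis hBa hB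
  exact ⟨ι, inferInstance, inferInstance, b, two_mul_card_eq_finrank b, h11, h22, h12⟩

end Literature.LinearAlgebra.Alternating

end
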